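import Summits.QuantumFields.YangMills.Theorems.BalabanUVNodesN19CoreTVInvariantBlocks
import Summits.QuantumFields.YangMills.Theorems.BalabanUVNodesN19CoreProductBlockFamily
import Mathlib.MeasureTheory.Constructions.Pi

/-!
# BalabanUVNodes ∕ N19 — THE CLASS-LEVEL CURRENCIES OVER A FINITE FAMILY OF INDEPENDENT BLOCKS: TV radii of `Measure.pi` laws compose `1 − ∏_b (1 − ρ_b) ≤ Σ_b ρ_b`,
# masses multiply — the N-block edition of files 1∕2, the class-level companion of g2's `core_pi` ∕ `relWeightBound_pi`

Cell `pub-ymgap` (HUMAN RULING D-0062 Track A ∕ D-0149 width seats), WIDTH SEAT `pub-ymgap-dag-n19-w2` (node n19 = NE7, seat 2 of 3), generation g4,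
CLAIM-3 ∕ INTENT-4 (INBOX l.29481).  Route `Summits/QuantumFields/YangMills/Theses/BalabanUVNodes.lean`, key item K3⁷ `SpineGivenEndpointR13SepCoPH` (stmt-QuantumFields-20544);
filed `--kind proof --supports … --as helper`.  COUNT-NEUTRAL.  THEOREMS ONLY (0 `def`, 0 `sorry`); imports this seat's g4 file 2 `…N19CoreTVInvariantBlocks` (through it file 1
`…N19TVProductBlocks`: the binary rule `abs_prod_real_sub_prod_real_le_of_tv`, `normalized_real`, `isProbabilityMeasure_normalized`, the radius arithmetic, and n19-c's
`…N19CoreTVInvariant.core_of_mass_of_tv`, g3's `…N19TVTiltSharpLeaf.tiltedMeanMatching_of_tv_half`), g2 `…N19CoreProductBlockFamily` (p594080: `one_sub_prod_one_sub_le_sum`,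
`mem_good_pi_iff` — the block bad-tuple convention) and Mathlib `MeasureTheory.Constructions.Pi` (`Measure.pi`, `measurePreserving_piFinSuccAbove`, `measurePreserving_piCongrLeft`,
`Measure.pi_pi`, `Measure.pi_univ`, `Measure.pi_eq`); edits nothing, re-declares nothing.

WHAT IS PROVED ([folklore] measure theory; «TV» = closeness of two (normalised) laws on every measurable SET).
* §1 probability laws: ★★ `abs_pi_real_sub_pi_real_le_of_tv_fin` (blocks indexed by `Fin n`: blockwise radii `ρ_i ∈ [0, 1]` ⇒ the `Measure.pi` laws are `(1 − ∏_i (1 − ρ_i))`-close on every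
  measurable set — induction along Mathlib's `piFinSuccAbove` splitting `(Π i, α i) ≃ᵐ α 0 × Π j, α (succ j)` with file 1's binary rule as the step) · ★★ `abs_pi_real_sub_pi_real_le_of_tv`
  (any `Fintype` index, transported along `piCongrLeft`) · ★ `abs_pi_real_sub_pi_real_le_sum_of_tv` (`≤ Σ_i ρ_i`, g2's union bound `one_sub_prod_one_sub_le_sum`) — EXACTLY the law of
  g2's `relWeightBound_pi` (`1 − ∏_b (1 − W_b) ≤ Σ_b W_b`); sharp already at two blocks (file 2 `tv_prod_sharp_toy`).
* §2 class pieces (finite measures, n19-c's normalised TV_cl letters, massless pieces reading `0`): `pi_univ_eq_zero_iff` · `normalized_pi` (`pi` of the normalised laws `=` a scalar multiple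
  of `pi`, via `Measure.pi_eq` on rectangles) · `pi_div_eq_normalized_pi_real` · `abs_pi_div_sub_zero_le_of_tv` (massless corner: a block massless in exactly one run has radius `1`, killing the
  product) · ★★ `abs_pi_div_sub_pi_div_le_of_tv` (blockwise TV_cl(ρ_i), `ρ_i ∈ [0,1]` ⇒ TV_cl(`1 − ∏_i (1 − ρ_i)`) for the `pi` pieces).
* §3 MASS: `massSandwich_pi` — masses MULTIPLY (`Measure.pi_univ`), so the `ℝ≥0∞` mass sandwiches compose `(Σ_i c_i, Σ_i r_i)`.
* §4 class level, g2's `core_pi` convention VERBATIM (blocks `b : β`, index `Π b, κ b`, classes `Fintype.piFinset (T · K)`, bad tuple ⟺ some block bad, class space `Π b, Ω b K`, pieces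
  `Measure.pi (fun b => μA b K (τ b))`): `isFiniteMeasure_piPiece` · ★ `massSandwich_piBlocks` (constants `Σ_b c_b K`, radius `Σ_b r_b K`) · ★★ `tvSandwich_piBlocks` (radius `1 − ∏_b (1 − ρ_b K)`) ·
  ★★ `core_piBlocks_of_mass_of_tv` (blockwise MASS_cl ∧ TV_cl ⇒ `Spine.NE7.Core` with ONE constant for EVERY bounded JOINT observable on the `pi` class space, width
  `Σ_b r_b K + (e^{2l₀B} − 1)·(1 − ∏_b (1 − ρ_b K))` — n19-c `core_of_mass_of_tv`) · ★ `tiltedMeanMatching_piBlocks_of_tv_half` (N14's binder at g3's half rate in that radius; summable once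
  `Σ_K Σ_b ρ_b K < ∞`).

HONEST FRAMING.  [folklore] measure theory on hypothesis SHAPES produced by nobody (blockwise TV_cl ∕ MASS_cl of two runs' class pieces); ZERO Bałaban content — [Balaban1988Convergent]
(2.18)'s history weights do NOT factor over blocks (the polymer coupling IS NE7's content); this only says what a finite family of INDEPENDENTLY matched blocks would buy.  NE7 ∕ NE1′ NOT
PRINTED as two-run statements for d = 4 and NOT proved; N14 ∕ N19 NOT discharged; K3⁷ OPEN, not claimed; counts UNMOVED (typed 28∕28 · discharged 5∕27 · A 5∕28); no count claim.  One finite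
four-torus programme at fixed `ε`; R4 closes the conditional finite-𝕋⁴ rung `BalabanLadder.UV` only — NOT ℝ⁴, NOT OS, NOT the Yang–Mills mass gap, NOT Clay.  0 `def`; 0 `sorry`; standard axioms.
-/

set_option autoImplicit false

noncomputable section

open MeasureTheory ProbabilityTheory
open scoped ENNReal

universe u v

namespace Summit.QuantumFields.YangMills.BalabanUVNodes.N19TVProductBlockFamily

open Summit.QuantumFields.BalabanUV.T4Continuum.NE1p.DressedMGFForm (MGFForm TiltedMeanMatching)
open Summit.QuantumFields.BalabanUV.T4Continuum.Spine.NE7 (Core)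
open Summit.QuantumFields.YangMills.BalabanUVNodes.N19TVProductBlocks
open Summit.QuantumFields.YangMills.BalabanUVNodes.N19CoreTVInvariant (core_of_mass_of_tv)
open Summit.QuantumFields.YangMills.BalabanUVNodes.N19TVTiltSharpLeaf (tiltedMeanMatching_of_tv_half)
open Summit.QuantumFields.YangMills.BalabanUVNodes.N19CoreProductBlockFamily (one_sub_prod_one_sub_le_sum mem_good_pi_iff)

/-! ## §1 Probability laws on a finite product: `1 − ∏ (1 − ρ_i)` [folklore] -/

section ProbabilityLaws

/-- ★★ **TV RADII OF A `Fin n`-FAMILY OF INDEPENDENT BLOCKS COMPOSE LIKE BAD WEIGHTS.**  Probability laws `μ_i, μ′_i` on `α i` (`i : Fin n`), blockwise `ρ_i`-close on every set with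
`ρ_i ∈ [0, 1]` ⇒ `Measure.pi μ′` and `Measure.pi μ` are `(1 − ∏_i (1 − ρ_i))`-close on every measurable set.  Induction on `n`: Mathlib's measure-preserving splitting
`piFinSuccAbove … 0 : (Π i, α i) ≃ᵐ α 0 × Π j, α (succ j)` reduces to file 1's binary rule with the tail radius `1 − ∏_j (1 − ρ_{succ j}) ∈ [0, 1]`. [folklore] -/
theorem abs_pi_real_sub_pi_real_le_of_tv_fin :
    ∀ (n : ℕ) (α : Fin n → Type u) [∀ i, MeasurableSpace (α i)] (μ μ' : ∀ i, Measure (α i)) [∀ i, IsProbabilityMeasure (μ i)]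
      [∀ i, IsProbabilityMeasure (μ' i)] (ρ : Fin n → ℝ), (∀ i, 0 ≤ ρ i ∧ ρ i ≤ 1) →
      (∀ i, ∀ S : Set (α i), MeasurableSet S → |(μ' i).real S - (μ i).real S| ≤ ρ i) →
      ∀ S : Set (∀ i, α i), MeasurableSet S → |(Measure.pi μ').real S - (Measure.pi μ).real S| ≤ 1 - ∏ i, (1 - ρ i) := by
  intro n
  induction n with
  | zero =>
    intro α _ μ μ' _ _ ρ _ _ S _
    rw [Fin.prod_univ_zero, sub_self]
    rcases S.eq_empty_or_nonempty with h | h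
    · subst h; simp
    · obtain ⟨y, hy⟩ := h
      have hSu : S = Set.univ := Set.eq_univ_of_forall fun x => by rwa [Subsingleton.elim x y]
      subst hSu; simp
  | succ n ih =>
    intro α _ μ μ' _ _ ρ hρ hTV S hS
    have hA : (Measure.pi μ) S =
        ((μ 0).prod (Measure.pi fun j => μ (Fin.succAbove 0 j))) ((MeasurableEquiv.piFinSuccAbove α 0).symm ⁻¹' S) :=
      (((measurePreserving_piFinSuccAbove μ 0).symm _).measure_preimage_equiv S).symm
    have hB : (Measure.pi μ') S =
        ((μ' 0).prod (Measure.pi fun j => μ' (Fin.succAbove 0 j))) ((MeasurableEquiv.piFinSuccAbove α 0).symm ⁻¹' S) :=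
      (((measurePreserving_piFinSuccAbove μ' 0).symm _).measure_preimage_equiv S).symm
    have hSe : MeasurableSet ((MeasurableEquiv.piFinSuccAbove α 0).symm ⁻¹' S) := hS.preimage (MeasurableEquiv.piFinSuccAbove α 0).symm.measurable
    have hP0 : 0 ≤ ∏ j : Fin n, (1 - ρ (Fin.succAbove 0 j)) := Finset.prod_nonneg fun j _ => sub_nonneg.2 (hρ _).2
    have hP1 : ∏ j : Fin n, (1 - ρ (Fin.succAbove 0 j)) ≤ 1 :=
      Finset.prod_le_one (fun j _ => sub_nonneg.2 (hρ _).2) fun j _ => sub_le_self _ (hρ _).1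
    have hrest : ∀ T : Set (∀ j : Fin n, α (Fin.succAbove 0 j)), MeasurableSet T →
        |(Measure.pi fun j => μ' (Fin.succAbove 0 j)).real T - (Measure.pi fun j => μ (Fin.succAbove 0 j)).real T| ≤
          1 - ∏ j : Fin n, (1 - ρ (Fin.succAbove 0 j)) :=
      ih (fun j => α (Fin.succAbove 0 j)) (fun j => μ (Fin.succAbove 0 j)) (fun j => μ' (Fin.succAbove 0 j))
        (fun j => ρ (Fin.succAbove 0 j)) (fun j => hρ _) (fun j => hTV _)
    have key := abs_prod_real_sub_prod_real_le_of_tv (p := μ 0) (p' := μ' 0) (q := Measure.pi fun j => μ (Fin.succAbove 0 j))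
      (q' := Measure.pi fun j => μ' (Fin.succAbove 0 j)) (ρ₁ := ρ 0) (by linarith) (by linarith) (hTV 0) hrest hSe
    rw [measureReal_def, measureReal_def, hB, hA, ← measureReal_def, ← measureReal_def]
    refine key.trans (le_of_eq ?_)
    rw [Fin.prod_univ_succAbove (fun i => 1 - ρ i) 0]
    ring

/-- ★★ **ANY FINITE INDEX**: probability laws `μ_i, μ′_i` (`i : ι`, `Fintype ι`) blockwise `ρ_i`-close (`ρ_i ∈ [0, 1]`) ⇒ the `Measure.pi` laws are `(1 − ∏_i (1 − ρ_i))`-close on every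
measurable set (the `Fin`-indexed rule transported along Mathlib's measure-preserving `piCongrLeft`). [folklore] -/
theorem abs_pi_real_sub_pi_real_le_of_tv {ι : Type v} [Fintype ι] {α : ι → Type u} [∀ i, MeasurableSpace (α i)] (μ μ' : ∀ i, Measure (α i))
    [∀ i, IsProbabilityMeasure (μ i)] [∀ i, IsProbabilityMeasure (μ' i)] {ρ : ι → ℝ} (hρ : ∀ i, 0 ≤ ρ i ∧ ρ i ≤ 1)
    (hTV : ∀ i, ∀ S : Set (α i), MeasurableSet S → |(μ' i).real S - (μ i).real S| ≤ ρ i) {S : Set (∀ i, α i)}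
    (hS : MeasurableSet S) : |(Measure.pi μ').real S - (Measure.pi μ).real S| ≤ 1 - ∏ i, (1 - ρ i) := by
  set f : Fin (Fintype.card ι) ≃ ι := (Fintype.equivFin ι).symm with hf
  have hA : (Measure.pi μ) S = (Measure.pi fun b => μ (f b)) (MeasurableEquiv.piCongrLeft α f ⁻¹' S) :=
    ((measurePreserving_piCongrLeft μ f).measure_preimage_equiv S).symm
  have hB : (Measure.pi μ') S = (Measure.pi fun b => μ' (f b)) (MeasurableEquiv.piCongrLeft α f ⁻¹' S) :=
    ((measurePreserving_piCongrLeft μ' f).measure_preimage_equiv S).symm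
  have key := abs_pi_real_sub_pi_real_le_of_tv_fin (Fintype.card ι) (fun b => α (f b)) (fun b => μ (f b)) (fun b => μ' (f b))
    (fun b => ρ (f b)) (fun b => hρ _) (fun b => hTV _) _ (hS.preimage (MeasurableEquiv.piCongrLeft α f).measurable)
  rw [measureReal_def, measureReal_def, hB, hA, ← measureReal_def, ← measureReal_def]
  refine key.trans (le_of_eq ?_)
  rw [Fintype.prod_equiv f (fun b => 1 - ρ (f b)) (fun i => 1 - ρ i) (fun _ => rfl)]

/-- ★ **THE UNION BOUND**: the `pi` laws are `(Σ_i ρ_i)`-close (g2's `one_sub_prod_one_sub_le_sum`). [folklore] -/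
theorem abs_pi_real_sub_pi_real_le_sum_of_tv {ι : Type v} [Fintype ι] {α : ι → Type u} [∀ i, MeasurableSpace (α i)] (μ μ' : ∀ i, Measure (α i))
    [∀ i, IsProbabilityMeasure (μ i)] [∀ i, IsProbabilityMeasure (μ' i)] {ρ : ι → ℝ} (hρ : ∀ i, 0 ≤ ρ i ∧ ρ i ≤ 1)
    (hTV : ∀ i, ∀ S : Set (α i), MeasurableSet S → |(μ' i).real S - (μ i).real S| ≤ ρ i) {S : Set (∀ i, α i)}
    (hS : MeasurableSet S) : |(Measure.pi μ').real S - (Measure.pi μ).real S| ≤ ∑ i, ρ i := by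
  classical
  exact (abs_pi_real_sub_pi_real_le_of_tv μ μ' hρ hTV hS).trans
    (one_sub_prod_one_sub_le_sum Finset.univ (fun i _ => (hρ i).1) (fun i _ => (hρ i).2))

end ProbabilityLaws

/-! ## §2 Class pieces: finite measures, normalised letters [folklore] -/

section ClassPieces

variable {ι : Type v} [Fintype ι] {α : ι → Type u} [∀ i, MeasurableSpace (α i)]

/-- A `pi` piece is massless iff some factor is. [folklore] -/
theorem pi_univ_eq_zero_iff (μ : ∀ i, Measure (α i)) [∀ i, IsFiniteMeasure (μ i)] :
    (Measure.pi μ) Set.univ = 0 ↔ ∃ i, μ i Set.univ = 0 := by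
  rw [Measure.pi_univ, Finset.prod_eq_zero_iff]
  simp

/-- **`pi` OF THE NORMALISED LAWS IS A SCALAR MULTIPLE OF THE `pi` LAW**: `Measure.pi (m_i⁻¹ • μ_i) = (∏_i m_i⁻¹) • Measure.pi μ` (`Measure.pi_eq` on measurable rectangles; no mass
condition is needed — `ℝ≥0∞` inversion of a zero mass reads `⊤`, and a massless block kills both sides). [folklore] -/
theorem normalized_pi (μ : ∀ i, Measure (α i)) [∀ i, IsFiniteMeasure (μ i)] :
    (Measure.pi fun i => (μ i Set.univ)⁻¹ • μ i) = (∏ i, (μ i Set.univ)⁻¹) • Measure.pi μ := by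
  refine Measure.pi_eq fun s _ => ?_
  rw [Measure.smul_apply, smul_eq_mul, Measure.pi_pi, ← Finset.prod_mul_distrib]
  simp only [Measure.smul_apply, smul_eq_mul]

/-- The normalised letters of a `pi` piece ARE the real letters of the `pi` of the normalised laws (no mass condition: `x ∕ 0 = 0` and `⊤.toReal = 0` agree on the massless corner). [folklore] -/
theorem pi_div_eq_normalized_pi_real (μ : ∀ i, Measure (α i)) [∀ i, IsFiniteMeasure (μ i)] (S : Set (∀ i, α i)) :
    (Measure.pi μ).real S / (Measure.pi μ).real Set.univ = (Measure.pi fun i => (μ i Set.univ)⁻¹ • μ i).real S := by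
  rw [normalized_pi μ, measureReal_ennreal_smul_apply, measureReal_def (Measure.pi μ) Set.univ, Measure.pi_univ,
    ENNReal.toReal_prod, ENNReal.toReal_prod, div_eq_inv_mul, ← Finset.prod_inv_distrib]
  congr 1
  exact Finset.prod_congr rfl fun i _ => (ENNReal.toReal_inv _).symm

/-- If one run's piece is massless in block `i` and the other's is not, that block's radius is `≥ 1` (file 1 `one_le_radius_of_mass_zero`), so the product `∏ (1 − ρ)` vanishes
(`ρ ≤ 1` blockwise). [folklore] -/
theorem prod_one_sub_eq_zero_of_block {μ μ' : ∀ i, Measure (α i)} [∀ i, IsFiniteMeasure (μ i)] [∀ i, IsFiniteMeasure (μ' i)] {ρ : ι → ℝ}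
    (hρ : ∀ i, 0 ≤ ρ i ∧ ρ i ≤ 1)
    (hTV : ∀ i, ∀ S : Set (α i), MeasurableSet S → |(μ' i).real S / (μ' i).real Set.univ - (μ i).real S / (μ i).real Set.univ| ≤ ρ i)
    {i : ι} (h0 : μ i Set.univ = 0) (h0' : μ' i Set.univ ≠ 0) : ∏ j, (1 - ρ j) = 0 := by
  have h1 : ρ i = 1 := le_antisymm (hρ i).2 (one_le_radius_of_mass_zero h0 h0' (hTV i))
  exact Finset.prod_eq_zero (Finset.mem_univ i) (by rw [h1, sub_self])

/-- The massless half: if run A's `pi` piece is massless the normalised gap is at most `1 − ∏ (1 − ρ_i)`. [folklore] -/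
theorem abs_pi_div_sub_zero_le_of_tv {μ μ' : ∀ i, Measure (α i)} [∀ i, IsFiniteMeasure (μ i)] [∀ i, IsFiniteMeasure (μ' i)] {ρ : ι → ℝ}
    (hρ : ∀ i, 0 ≤ ρ i ∧ ρ i ≤ 1)
    (hTV : ∀ i, ∀ S : Set (α i), MeasurableSet S → |(μ' i).real S / (μ' i).real Set.univ - (μ i).real S / (μ i).real Set.univ| ≤ ρ i)
    (hA : (Measure.pi μ) Set.univ = 0) (S : Set (∀ i, α i)) :
    |(Measure.pi μ').real S / (Measure.pi μ').real Set.univ - (Measure.pi μ).real S / (Measure.pi μ).real Set.univ| ≤ 1 - ∏ i, (1 - ρ i) := by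
  have hunit' := div_univ_mem_unit (Measure.pi μ') S
  have hP1 : ∏ i, (1 - ρ i) ≤ 1 := Finset.prod_le_one (fun i _ => sub_nonneg.2 (hρ i).2) fun i _ => sub_le_self _ (hρ i).1
  rw [div_univ_eq_zero_of_mass _ hA, sub_zero, abs_of_nonneg hunit'.1]
  by_cases hB : (Measure.pi μ') Set.univ = 0
  · rw [div_univ_eq_zero_of_mass _ hB]; linarith
  · obtain ⟨i, hi⟩ := (pi_univ_eq_zero_iff μ).1 hA
    have hB' : μ' i Set.univ ≠ 0 := fun h => hB ((pi_univ_eq_zero_iff μ').2 ⟨i, h⟩)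
    rw [prod_one_sub_eq_zero_of_block hρ hTV hi hB', sub_zero]
    exact hunit'.2

/-- ★★ **TV_cl OF `pi` CLASS PIECES.**  Two runs' class pieces `μ_i, μ′_i` (finite measures) on the blocks `α i` of a finite family, blockwise TV_cl in n19-c's normalised letters with radii
`ρ_i ∈ [0, 1]` ⇒ the `pi` pieces satisfy TV_cl with radius `1 − ∏_i (1 − ρ_i)`; massless corners included (a block massless in exactly one run kills the product). [folklore] -/
theorem abs_pi_div_sub_pi_div_le_of_tv {μ μ' : ∀ i, Measure (α i)} [∀ i, IsFiniteMeasure (μ i)] [∀ i, IsFiniteMeasure (μ' i)] {ρ : ι → ℝ}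
    (hρ : ∀ i, 0 ≤ ρ i ∧ ρ i ≤ 1)
    (hTV : ∀ i, ∀ S : Set (α i), MeasurableSet S → |(μ' i).real S / (μ' i).real Set.univ - (μ i).real S / (μ i).real Set.univ| ≤ ρ i)
    {S : Set (∀ i, α i)} (hS : MeasurableSet S) :
    |(Measure.pi μ').real S / (Measure.pi μ').real Set.univ - (Measure.pi μ).real S / (Measure.pi μ).real Set.univ| ≤ 1 - ∏ i, (1 - ρ i) := by
  by_cases hA : (Measure.pi μ) Set.univ = 0
  · exact abs_pi_div_sub_zero_le_of_tv hρ hTV hA S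
  by_cases hB : (Measure.pi μ') Set.univ = 0
  · rw [abs_sub_comm]
    have hTV' : ∀ i, ∀ S : Set (α i), MeasurableSet S →
        |(μ i).real S / (μ i).real Set.univ - (μ' i).real S / (μ' i).real Set.univ| ≤ ρ i := fun i S hS => by
      rw [abs_sub_comm]; exact hTV i S hS
    exact abs_pi_div_sub_zero_le_of_tv hρ hTV' hB S
  -- all masses nonzero: normalise and apply §1
  have hA' : ∀ i, μ i Set.univ ≠ 0 := fun i h => hA ((pi_univ_eq_zero_iff μ).2 ⟨i, h⟩)
  have hB' : ∀ i, μ' i Set.univ ≠ 0 := fun i h => hB ((pi_univ_eq_zero_iff μ').2 ⟨i, h⟩)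
  haveI : ∀ i, IsProbabilityMeasure ((μ i Set.univ)⁻¹ • μ i) := fun i => isProbabilityMeasure_normalized (hA' i)
  haveI : ∀ i, IsProbabilityMeasure ((μ' i Set.univ)⁻¹ • μ' i) := fun i => isProbabilityMeasure_normalized (hB' i)
  have h' : ∀ i, ∀ S : Set (α i), MeasurableSet S → |((μ' i Set.univ)⁻¹ • μ' i).real S - ((μ i Set.univ)⁻¹ • μ i).real S| ≤ ρ i :=
    fun i S hS => by rw [normalized_real, normalized_real]; exact hTV i S hS
  rw [pi_div_eq_normalized_pi_real μ', pi_div_eq_normalized_pi_real μ]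
  exact abs_pi_real_sub_pi_real_le_of_tv (fun i => (μ i Set.univ)⁻¹ • μ i) (fun i => (μ' i Set.univ)⁻¹ • μ' i) hρ h' hS

end ClassPieces

/-! ## §3 MASS: masses multiply, mass sandwiches compose `(Σ c_i, Σ r_i)` [folklore] -/

section Mass

variable {ι : Type v} [Fintype ι] {α : ι → Type u} [∀ i, MeasurableSpace (α i)]

/-- **MASS SANDWICHES COMPOSE OVER A FINITE FAMILY OF BLOCKS** (n19-c's `ℝ≥0∞` MASS_cl letters): blockwise `e^{c_i − r_i}·mA_i ≤ mB_i ≤ e^{c_i + r_i}·mA_i` ⇒ the `pi` pieces' masses are sandwiched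
with `(Σ_i c_i, Σ_i r_i)` (`Measure.pi_univ`, `Real.exp_sum`). [folklore] -/
theorem massSandwich_pi {μA μB : ∀ i, Measure (α i)} [∀ i, IsFiniteMeasure (μA i)] [∀ i, IsFiniteMeasure (μB i)] {c r : ι → ℝ}
    (h : ∀ i, ENNReal.ofReal (Real.exp (c i - r i)) * μA i Set.univ ≤ μB i Set.univ ∧
      μB i Set.univ ≤ ENNReal.ofReal (Real.exp (c i + r i)) * μA i Set.univ) :
    ENNReal.ofReal (Real.exp (∑ i, c i - ∑ i, r i)) * (Measure.pi μA) Set.univ ≤ (Measure.pi μB) Set.univ ∧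
      (Measure.pi μB) Set.univ ≤ ENNReal.ofReal (Real.exp (∑ i, c i + ∑ i, r i)) * (Measure.pi μA) Set.univ := by
  have e : ∀ x : ι → ℝ, ENNReal.ofReal (Real.exp (∑ i, x i)) = ∏ i, ENNReal.ofReal (Real.exp (x i)) := fun x => by
    rw [Real.exp_sum, ENNReal.ofReal_prod_of_nonneg fun i _ => (Real.exp_pos _).le]
  rw [Measure.pi_univ, Measure.pi_univ, ← Finset.sum_sub_distrib, ← Finset.sum_add_distrib, e, e, ← Finset.prod_mul_distrib,
    ← Finset.prod_mul_distrib]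
  exact ⟨Finset.prod_le_prod (fun _ _ => zero_le) fun i _ => (h i).1, Finset.prod_le_prod (fun _ _ => zero_le) fun i _ => (h i).2⟩

end Mass



/-! ## §4 Class level: a finite family of blocks, g2's `core_pi` convention [folklore] -/

section Blocks

variable {β : Type v} [Fintype β] [DecidableEq β] {κ : β → Type v} [∀ b, DecidableEq (κ b)]
  {Ω : β → ℕ → Type u} [∀ b K, MeasurableSpace (Ω b K)]
  {l₀ vol B : ℝ} {T : ∀ b : β, ℕ → Finset (κ b)} {Bad : ∀ b : β, ℕ → ℝ → Finset (κ b)}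
  {μA μB : ∀ (b : β) (K : ℕ), κ b → Measure (Ω b K)} {r ρ : β → ℕ → ℝ} {δ : ℕ → ℝ}
  {W : ∀ K, (∀ b, Ω b K) → ℝ} {P Q : ℕ → ℝ → (∀ b, κ b) → ℝ}

omit [∀ b, DecidableEq (κ b)] in
/-- The `pi` class pieces are finite on the `piFinset` classes. [folklore] -/
theorem isFiniteMeasure_piPiece (hfin : ∀ b K, ∀ x ∈ T b K, IsFiniteMeasure (μA b K x)) :
    ∀ K, ∀ τ ∈ Fintype.piFinset (fun b => T b K), IsFiniteMeasure (Measure.pi fun b => μA b K (τ b)) := fun K τ hτ => by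
  haveI : ∀ b, IsFiniteMeasure (μA b K (τ b)) := fun b => hfin b K _ (Fintype.mem_piFinset.1 hτ b)
  infer_instance

/-- ★ **MASS_cl OVER A FINITE FAMILY OF BLOCKS** (n19-c's `ℝ≥0∞` letters, `core_of_mass_of_tv`'s hypothesis `hM` VERBATIM on the `pi` datum): blockwise MASS_cl(r_b) with constants
`c_b K` ⇒ MASS_cl(Σ_b r_b) with the constant `Σ_b c_b K` (§3 `massSandwich_pi`). [folklore] -/
theorem massSandwich_piBlocks (hfinA : ∀ b K, ∀ x ∈ T b K, IsFiniteMeasure (μA b K x)) (hfinB : ∀ b K, ∀ x ∈ T b K, IsFiniteMeasure (μB b K x))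
    (hM : ∀ b K, ∃ c : ℝ, ∀ t : ℝ, |t| ≤ l₀ → ∀ x ∈ T b K \ Bad b K t,
      ENNReal.ofReal (Real.exp (c - r b K)) * μA b K x Set.univ ≤ μB b K x Set.univ ∧
        μB b K x Set.univ ≤ ENNReal.ofReal (Real.exp (c + r b K)) * μA b K x Set.univ) :
    ∀ K : ℕ, ∃ c : ℝ, ∀ t : ℝ, |t| ≤ l₀ →
      ∀ τ ∈ Fintype.piFinset (fun b => T b K) \ (Fintype.piFinset fun b => T b K).filter (fun τ => ∃ b, τ b ∈ Bad b K t),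
        ENNReal.ofReal (Real.exp (c - ∑ b, r b K)) * (Measure.pi fun b => μA b K (τ b)) Set.univ ≤ (Measure.pi fun b => μB b K (τ b)) Set.univ ∧
          (Measure.pi fun b => μB b K (τ b)) Set.univ ≤ ENNReal.ofReal (Real.exp (c + ∑ b, r b K)) * (Measure.pi fun b => μA b K (τ b)) Set.univ := by
  intro K
  choose c hc using fun b => hM b K
  refine ⟨∑ b, c b, fun t ht τ hτ => ?_⟩
  have hgood : ∀ b, τ b ∈ T b K \ Bad b K t := mem_good_pi_iff.1 hτ
  haveI : ∀ b, IsFiniteMeasure (μA b K (τ b)) := fun b => hfinA b K _ (Finset.mem_sdiff.1 (hgood b)).1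
  haveI : ∀ b, IsFiniteMeasure (μB b K (τ b)) := fun b => hfinB b K _ (Finset.mem_sdiff.1 (hgood b)).1
  exact massSandwich_pi (c := c) (r := fun b => r b K) fun b => hc b t ht (τ b) (hgood b)

/-- ★★ **TV_cl OVER A FINITE FAMILY OF BLOCKS** (n19-c's normalised letters, `core_of_mass_of_tv`'s hypothesis `hTV` VERBATIM on the `pi` datum): blockwise TV_cl(ρ_b),
`ρ_b K ∈ [0, 1]` ⇒ TV_cl(`1 − ∏_b (1 − ρ_b K)`) for the `pi` pieces (§2 `abs_pi_div_sub_pi_div_le_of_tv`). [folklore] -/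
theorem tvSandwich_piBlocks (hfinA : ∀ b K, ∀ x ∈ T b K, IsFiniteMeasure (μA b K x)) (hfinB : ∀ b K, ∀ x ∈ T b K, IsFiniteMeasure (μB b K x))
    (hρ : ∀ b K, 0 ≤ ρ b K ∧ ρ b K ≤ 1)
    (hTV : ∀ b (K : ℕ) (t : ℝ), |t| ≤ l₀ → ∀ x ∈ T b K \ Bad b K t, ∀ S : Set (Ω b K), MeasurableSet S →
      |(μB b K x).real S / (μB b K x).real Set.univ - (μA b K x).real S / (μA b K x).real Set.univ| ≤ ρ b K) :
    ∀ (K : ℕ) (t : ℝ), |t| ≤ l₀ →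
      ∀ τ ∈ Fintype.piFinset (fun b => T b K) \ (Fintype.piFinset fun b => T b K).filter (fun τ => ∃ b, τ b ∈ Bad b K t),
        ∀ S : Set (∀ b, Ω b K), MeasurableSet S →
          |(Measure.pi fun b => μB b K (τ b)).real S / (Measure.pi fun b => μB b K (τ b)).real Set.univ -
              (Measure.pi fun b => μA b K (τ b)).real S / (Measure.pi fun b => μA b K (τ b)).real Set.univ| ≤ 1 - ∏ b, (1 - ρ b K) := by
  intro K t ht τ hτ S hS
  have hgood : ∀ b, τ b ∈ T b K \ Bad b K t := mem_good_pi_iff.1 hτ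
  haveI : ∀ b, IsFiniteMeasure (μA b K (τ b)) := fun b => hfinA b K _ (Finset.mem_sdiff.1 (hgood b)).1
  haveI : ∀ b, IsFiniteMeasure (μB b K (τ b)) := fun b => hfinB b K _ (Finset.mem_sdiff.1 (hgood b)).1
  exact abs_pi_div_sub_pi_div_le_of_tv (μ := fun b => μA b K (τ b)) (μ' := fun b => μB b K (τ b)) (fun b => hρ b K)
    (fun b => hTV b K t ht (τ b) (hgood b)) hS

/-- ★★ **BLOCKWISE MASS_cl ∧ TV_cl ⇒ `Core` FOR EVERY BOUNDED JOINT OBSERVABLE ON THE `pi` CLASS SPACE, ONE CONSTANT.**  A finite family of independent blocks with blockwise MASS_cl(r_b)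
and TV_cl(ρ_b) (`ρ_b K ∈ [0, 1]`); a JOINT observable family `W_K : (Π b, Ω b K) → ℝ`, `|W| ≤ B`, with dressed class terms `P`, `Q` in MGF form on the `pi` pieces ⇒
`Spine.NE7.Core l₀ vol T Bad P Q δ` on the `pi` datum (g2's `core_pi` key) with the constant `Σ_b c_b K`, for any width
`vol·δ_K ≥ Σ_b r_b K + (e^{2l₀B} − 1)·(1 − ∏_b (1 − ρ_b K))` — §4 ∘ n19-c `core_of_mass_of_tv`; g2's term-level `core_pi` reaches only product observables. [folklore] -/
theorem core_piBlocks_of_mass_of_tv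
    (hP : MGFForm B (fun K => Fintype.piFinset fun b => T b K) W (fun K τ => Measure.pi fun b => μA b K (τ b)) P)
    (hQ : MGFForm B (fun K => Fintype.piFinset fun b => T b K) W (fun K τ => Measure.pi fun b => μB b K (τ b)) Q)
    (hfinA : ∀ b K, ∀ x ∈ T b K, IsFiniteMeasure (μA b K x)) (hfinB : ∀ b K, ∀ x ∈ T b K, IsFiniteMeasure (μB b K x))
    (hM : ∀ b K, ∃ c : ℝ, ∀ t : ℝ, |t| ≤ l₀ → ∀ x ∈ T b K \ Bad b K t,
      ENNReal.ofReal (Real.exp (c - r b K)) * μA b K x Set.univ ≤ μB b K x Set.univ ∧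
        μB b K x Set.univ ≤ ENNReal.ofReal (Real.exp (c + r b K)) * μA b K x Set.univ)
    (hρ : ∀ b K, 0 ≤ ρ b K ∧ ρ b K ≤ 1)
    (hTV : ∀ b (K : ℕ) (t : ℝ), |t| ≤ l₀ → ∀ x ∈ T b K \ Bad b K t, ∀ S : Set (Ω b K), MeasurableSet S →
      |(μB b K x).real S / (μB b K x).real Set.univ - (μA b K x).real S / (μA b K x).real Set.univ| ≤ ρ b K)
    (hw : ∀ K, ∑ b, r b K + (Real.exp (2 * (l₀ * B)) - 1) * (1 - ∏ b, (1 - ρ b K)) ≤ vol * δ K) :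
    Core l₀ vol (fun K => Fintype.piFinset fun b => T b K) (fun K t => (Fintype.piFinset fun b => T b K).filter fun τ => ∃ b, τ b ∈ Bad b K t)
      P Q δ :=
  core_of_mass_of_tv (Bad := fun K t => (Fintype.piFinset fun b => T b K).filter fun τ => ∃ b, τ b ∈ Bad b K t) (r₁ := fun K => ∑ b, r b K)
    (ρ := fun K => 1 - ∏ b, (1 - ρ b K)) hP hQ (massSandwich_piBlocks hfinA hfinB hM) (tvSandwich_piBlocks hfinA hfinB hρ hTV) hw

/-- ★ **BLOCKWISE TV_cl ⇒ N14's BINDER FOR EVERY BOUNDED JOINT OBSERVABLE ON THE `pi` CLASS SPACE**, at g3's HALF rate `2B·e^{2l₀B}·(1 − ∏_b (1 − ρ_b K))` — summable once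
`Σ_K Σ_b ρ_b K < ∞` (§1's union bound). [folklore] -/
theorem tiltedMeanMatching_piBlocks_of_tv_half
    (hfinA : ∀ b K, ∀ x ∈ T b K, IsFiniteMeasure (μA b K x)) (hfinB : ∀ b K, ∀ x ∈ T b K, IsFiniteMeasure (μB b K x))
    (hB : 0 ≤ B) (hWm : ∀ K, Measurable (W K)) (hWb : ∀ K ω, |W K ω| ≤ B) (hρ : ∀ b K, 0 ≤ ρ b K ∧ ρ b K ≤ 1)
    (hTV : ∀ b (K : ℕ) (t : ℝ), |t| ≤ l₀ → ∀ x ∈ T b K \ Bad b K t, ∀ S : Set (Ω b K), MeasurableSet S →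
      |(μB b K x).real S / (μB b K x).real Set.univ - (μA b K x).real S / (μA b K x).real Set.univ| ≤ ρ b K) :
    TiltedMeanMatching l₀ (fun K => Fintype.piFinset fun b => T b K) (fun K t => (Fintype.piFinset fun b => T b K).filter fun τ => ∃ b, τ b ∈ Bad b K t)
      W (fun K τ => Measure.pi fun b => μA b K (τ b)) W (fun K τ => Measure.pi fun b => μB b K (τ b)) fun K =>
      2 * B * Real.exp (2 * (l₀ * B)) * (1 - ∏ b, (1 - ρ b K)) :=
  tiltedMeanMatching_of_tv_half (Bad := fun K t => (Fintype.piFinset fun b => T b K).filter fun τ => ∃ b, τ b ∈ Bad b K t)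
    (ρ := fun K => 1 - ∏ b, (1 - ρ b K)) (isFiniteMeasure_piPiece hfinA) (isFiniteMeasure_piPiece hfinB) hB hWm hWb
    (tvSandwich_piBlocks hfinA hfinB hρ hTV)

end Blocks

end Summit.QuantumFields.YangMills.BalabanUVNodes.N19TVProductBlockFamily

end
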